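import Summits.BirchSwinnertonDyer.BirchSwinnertonDyer.Theorems.ResidualThetaTransportAtTwoResidualSignedLambdaLowerCMAtTwoMazurTateValuesRelayAt
import Summits.BirchSwinnertonDyer.BirchSwinnertonDyer.Theorems.ResidualThetaTransportAtTwoResidualSignedLambdaLowerCMAtTwoColemanPlusTorsor
import HarnessLib

/-!
# The ∀-DISCHARGE of the values relay (STUB-PLAN S143, row 96): Mazur–Tate congruences MOVE from ONE admitted Honda datum to EVERY
# datum admitted by the pins' plus Coleman map — `hMT_of_hMT_along`, `hERL_of_mazurTateValues_along`

Route `ResidualThetaTransportAtTwo` (RTT), crux RSL_g `ResidualSignedLambdaLowerCMAtTwo` (stmt-BirchSwinnertonDyer-22608), line `onepair` v3f,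
station (R) `stub_kzgValueRelation` of the KZ_g interior (stmt-BirchSwinnertonDyer-24105 hold-opening). Seat `bsd-wall-tp2-p2x-w2` g21 (width seat;
`--supports`, closes nothing). THEOREMS ONLY (no definition, no named fact, no instance, no `sorry`). BSD is not proved by any of this; RSL_g / KZ_g
stay OPEN.

WHY. The landed relay `MazurTateValuesRelay.hERL_of_mazurTateValues_at` (p715483) asks for the Mazur–Tate congruences MTV_Λ (unfolded, multiplier
`μt` named) **for every Honda datum `(gH, dH)` admitted by the pin `π.hcol`**, while station (R)'s print input (child A's valued class, S143's
MTV(c)) delivers them along ONE displayed datum `c = (g′, d′)`. The stub-critic's road (STUB-PLAN rev 27.1 §0.8 S143, row 96 k4-g24 §2–§3): a second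
pinned column along `(g′, d′)` is `u · π.col` with `u ∈ ℤ₂⟦X⟧ˣ` (the torsor, landed `OnePair.OnePairPins.exists_unit_mul_col_of_pin`, p713788); the
two congruences (5) for the SAME functional give `ω_{2m} ∣ P′ − u·P` (T5); pushed through the `map ι`-semilinear `e` (T8); and the cleared Mazur–Tate
congruence moves from `P⃗′` to `P⃗` with the unit `w ↦ w · map ι u` at the SAME `μt` (T6 = landed `congr_of_dvd_sub`). No inverse, no formal-group
membership of the handed datum, no new mathematics.

* §1 `dvd_sub_mul_of_congr_pair` (T5), `map_dvd_sub_of_forall_dvd` (T8) — adapted from `Cruxes/ResidualThetaCountLowerPureAtTwo/Sketch_sidea_k4_g24.lean`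
  §2–§3 (stub-ideation k4 g24, row 96 PASS), kernel-checked there; pure commutative algebra.
* §2 **`hMT_of_hMT_along`**: MTV_Λ at `μt` along ONE pinned column datum `(col′, g′, d′)` at `π.v` ⟹ the `hMT` ∀-hypothesis of
  `hERL_of_mazurTateValues_at` VERBATIM; **`hERL_of_mazurTateValues_along`**: the composition — `∃ ν u, ν ≠ 0 ∧ IsUnit u ∧ C ν · e(𝒸 z) = μt·(L⁻·u)`
  from MTV_Λ along one handed pinned column datum.

References: [Kato2004Asterisque] Thm. 12.5 (1) (p. 221); [Kobayashi2003] Thm. 6.2, (8.20)–(8.26); [Washington1997] Prop. 7.2, §13.2; [Pollack2003] Prop. 6.18.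
-/

set_option autoImplicit false
-- D-0017: single-problem summit, so `Summit.BirchSwinnertonDyer.BirchSwinnertonDyer.…` repeats a namespace BY DESIGN.
set_option linter.dupNamespace false

noncomputable section

open scoped Classical Polynomial

namespace Summit.BirchSwinnertonDyer.BirchSwinnertonDyer.Theorems.ThetaTransport.MazurTateValuesRelay

open Polynomial (X C)
open Literature.NumberTheory.EllipticCurves Literature.NumberTheory.EllipticCurves.ModularForms CongruenceSubgroup
  Literature.NumberTheory.Automorphic
  Summit.BirchSwinnertonDyer.BirchSwinnertonDyer.Theorems.PollackPairK
  Literature.NumberTheory.EllipticCurves.GreenbergSelmer Literature.NumberTheory.GaloisRepresentations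
  NumberField IsDedekindDomain Field Kobayashi2003 Rat.HeightOneSpectrum
  Literature.NumberTheory.EllipticCurves.Sprung2012
  Summit.BirchSwinnertonDyer.BirchSwinnertonDyer.Theorems.OnePair

/-! ## §1 Transfer algebra (T5, T8) -/

section Algebra

-- adapted from Cruxes/ResidualThetaCountLowerPureAtTwo/Sketch_sidea_k4_g24.lean §2–§3 (stub-ideation k4 g24; kernel-checked there)

variable {R A : Type*} [CommRing R] [CommRing A]

/-- **T5.** Two congruences `ω ∣ P₁ + s·L₁`, `ω ∣ P₂ + s·L₂` with `L₂ = u·L₁` give `ω ∣ P₂ − u·P₁` (two pinned columns along two data, one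
functional). [cite: Kobayashi2003, Thm. 6.2 (6.13)] -/
theorem dvd_sub_mul_of_congr_pair {ω s P₁ P₂ L₁ L₂ u : R} (h₁ : ω ∣ P₁ + s * L₁) (h₂ : ω ∣ P₂ + s * L₂) (hu : L₂ = u * L₁) :
    ω ∣ P₂ - u * P₁ := by
  have h : P₂ - u * P₁ = (P₂ + s * L₂) - u * (P₁ + s * L₁) := by rw [hu]; ring
  rw [h]
  exact dvd_sub h₂ (dvd_mul_of_dvd_right h₁ u)

/-- **T8.** Coordinatewise `ω ∣ t₁ i − u·t₂ i` pushed through an additive `φ`-semilinear `e` (the relay's binder `he`): `φ ω ∣ e t₁ − φ u · e t₂`.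
[cite: Kato2004Asterisque, Thm. 12.5 (1) (p. 221)] -/
theorem map_dvd_sub_of_forall_dvd {ι' : Type*} {F : Type*} [FunLike F (ι' → R) A] [AddMonoidHomClass F (ι' → R) A]
    (φ : R →+* A) (e : F) (he : ∀ (r : R) (t : ι' → R), e (r • t) = φ r * e t) {ω u : R} {t₁ t₂ : ι' → R}
    (h : ∀ i, ω ∣ t₁ i - u * t₂ i) : φ ω ∣ e t₁ - φ u * e t₂ := by
  choose c hc using h
  have ht : t₁ - u • t₂ = ω • c := funext fun i => by simpa [Pi.smul_apply, smul_eq_mul] using hc i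
  refine ⟨e c, ?_⟩
  rw [← he u t₂, ← he ω c, ← ht, map_sub]

end Algebra

/-! ## §2 The ∀-discharge: MTV_Λ along one pinned column datum ⟹ MTV_Λ along every datum admitted by `π.col` -/

section Transfer

variable {M : ℕ} {g : CuspForm (Gamma0 M) 2} {ι : coeffField g →+* PadicAlgCl 2} {Ω : ℂ}
  {W : WeierstrassCurve ℚ} [W.IsElliptic] {κ : ZpExtension ℚ 2} {γ : absoluteGaloisGroup ℚ}
  {S₀ : Finset (HeightOneSpectrum (𝓞 ℚ))} {n : ℕ} {ρ : FramedGaloisRep ℚ ↥(padicCoeffIntegers (Set.range ι)) 2}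
  {Θ : ∀ v : HeightOneSpectrum (𝓞 ℚ), ((2 : ℕ) : 𝓞 ℚ) ∈ v.asIdeal →
    (Cofree ρ ↥(padicCoeffField (Set.range ι)) ≃+ (Fin n → ↥(W.geomPrimaryTorsion 2)))}
  {hΘ : ∀ v hv (δ : absoluteGaloisGroup (v.adicCompletion ℚ)) m i,
    Θ v hv (resGalOfEmb (closureEmb (K := ℚ) (v.adicCompletion ℚ)) δ • m) i =
      resGalOfEmb (closureEmb (K := ℚ) (v.adicCompletion ℚ)) δ • Θ v hv m i}
  {I : Kato2004.IwasawaH1DataCoeff (FramedGaloisRep.toGaloisRep ρ) 2 κ γ}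
  {Sg : AddSubgroup (subgroupH1 κ.kerSubgroup (Cofree ρ ↥(padicCoeffField (Set.range ι))))}
  [Module ↥(padicCoeffIntegers (Set.range ι)) ↥Sg]

set_option maxHeartbeats 1600000 in
/-- **THE ∀-DISCHARGE (S143 / row 96, PROVED).** Let `π` be a pin bundle, `z ∈ 𝐇¹`, `e : ℤ₂⟦X⟧ⁿ ≃+ Λ_𝒪` additive and `map ι`-semilinear, `μt ∈ Λ_𝒪`.
Suppose a SECOND `ℤ₂`-linear plus Coleman map `col′` at `π.v` is pinned by the congruences (5) and uniqueness (6) along a HANDED datum `(g′, d′)`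
(`g′` a `κ`-generator, `d′_m ∈ E(ℚ_{m,v})`), onto, with the datum-free kernel, and that MTV_Λ holds at `μt` ALONG `(g′, d′)`:
`∃ ν ≠ 0, w ∈ Λ_𝒪ˣ, ∀ m ∃ k q, 2^k·(ι_Λ μt · θ_{2m}(g)^ι − ι_Λ(C ν · w · e(P⃗′_{2m}(z)))) = ω_{2m} · ι_Λ q`. THEN MTV_Λ holds at the same `μt` along
EVERY datum `(gH, dH)` admitted by `π.col` — the `hMT` hypothesis of `hERL_of_mazurTateValues_at` VERBATIM (with the unit `w · map ι u`,
`col′ = u · π.col`). [cite: Kato2004Asterisque, Thm. 12.5 (1) (p. 221)] [cite: Kobayashi2003, Thm. 6.2, (8.20)–(8.26)] [cite: Washington1997, Prop. 7.2] -/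
theorem hMT_of_hMT_along
    (π : OnePairPins (Set.range ι) W κ γ S₀ n ρ Θ hΘ I Sg) (z : I.H)
    (e : (Fin n → PowerSeries ℤ_[2]) ≃+ IwasawaAlgebraO (Set.range ι))
    (he : ∀ (r : PowerSeries ℤ_[2]) (t : Fin n → PowerSeries ℤ_[2]),
      e (r • t) = PowerSeries.map (padicIntToCoeffIntegers (Set.range ι)) r * e t)
    (μt : IwasawaAlgebraO (Set.range ι))
    -- a second pinned plus Coleman map along a handed datum `(g′, d′)` at `π.v`
    (col' : (↥(localTowerPointsOfEmb κ (closureEmb (K := ℚ) (π.v.adicCompletion ℚ)) W) →+ ℤ_[2]) →ₗ[ℤ_[2]] PowerSeries ℤ_[2])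
    (g' : absoluteGaloisGroup (π.v.adicCompletion ℚ)) (d' : ℕ → localPoints W (π.v.adicCompletion ℚ))
    (hdA' : ∀ m j, g' ^ j • d' m ∈ localTowerPointsOfEmb κ (closureEmb (K := ℚ) (π.v.adicCompletion ℚ)) W)
    (hg' : κ.IsTopGenerator (resGalOfEmb (closureEmb (K := ℚ) (π.v.adicCompletion ℚ)) g'))
    (hd' : ∀ m, d' m ∈ localLayerPointsOfEmb κ (closureEmb (K := ℚ) (π.v.adicCompletion ℚ)) W m)
    (hcong' : ∀ (z' : ↥(localTowerPointsOfEmb κ (closureEmb (K := ℚ) (π.v.adicCompletion ℚ)) W) →+ ℤ_[2]) (m : ℕ),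
      (((cyclotomicOmega 2 (2 * m)).map (Int.castRingHom ℤ_[2]) : ℤ_[2][X]) : PowerSeries ℤ_[2]) ∣
        ((∑ j ∈ Finset.range (2 ^ (2 * m)), Polynomial.C (z' ⟨g' ^ j • d' (2 * m), hdA' (2 * m) j⟩) * (Polynomial.X + 1) ^ j :
            ℤ_[2][X]) : PowerSeries ℤ_[2]) +
          (-1 : PowerSeries ℤ_[2]) ^ m * (((cyclotomicOmegaMinus 2 (2 * m)).map (Int.castRingHom ℤ_[2]) : ℤ_[2][X]) : PowerSeries ℤ_[2]) *
            col' z')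
    (hpin' : ∀ (z' : ↥(localTowerPointsOfEmb κ (closureEmb (K := ℚ) (π.v.adicCompletion ℚ)) W) →+ ℤ_[2]) (L : PowerSeries ℤ_[2]),
      (∀ m : ℕ, (((cyclotomicOmega 2 (2 * m)).map (Int.castRingHom ℤ_[2]) : ℤ_[2][X]) : PowerSeries ℤ_[2]) ∣
        ((∑ j ∈ Finset.range (2 ^ (2 * m)), Polynomial.C (z' ⟨g' ^ j • d' (2 * m), hdA' (2 * m) j⟩) * (Polynomial.X + 1) ^ j :
            ℤ_[2][X]) : PowerSeries ℤ_[2]) +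
          (-1 : PowerSeries ℤ_[2]) ^ m * (((cyclotomicOmegaMinus 2 (2 * m)).map (Int.castRingHom ℤ_[2]) : ℤ_[2][X]) : PowerSeries ℤ_[2]) *
            L) → L = col' z')
    (hsurj' : Function.Surjective col')
    (hker' : ∀ z' : ↥(localTowerPointsOfEmb κ (closureEmb (K := ℚ) (π.v.adicCompletion ℚ)) W) →+ ℤ_[2],
      col' z' = 0 ↔ ∀ (m : ℕ) (x : localPoints W (π.v.adicCompletion ℚ)) (hx : x ∈ signedLocalPoints κ (π.v.adicCompletion ℚ) W 1 m),
        z' ⟨x, localLayerPointsOfEmb_le_localTowerPointsOfEmb κ (closureEmb (K := ℚ) (π.v.adicCompletion ℚ)) W m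
          (signedLocalPointsOfEmb_le κ (closureEmb (K := ℚ) (π.v.adicCompletion ℚ)) W 1 m hx)⟩ = 0)
    -- MTV_Λ at `μt` ALONG `(g′, d′)`
    (hMT' : ∃ (ν : padicCoeffIntegers (Set.range ι)) (w : IwasawaAlgebraO (Set.range ι)),
        ν ≠ 0 ∧ IsUnit w ∧
        ∀ m : ℕ, ∃ (k : ℕ) (q : IwasawaAlgebraO (Set.range ι)),
          PowerSeries.C ((2 : PadicAlgCl 2) ^ k) *
              (iwasawaOToPowerSeries (Set.range ι) μt *
                  (((mazurTateElementK g Ω 2 (2 * m)).map ι : (PadicAlgCl 2)[X]) : PowerSeries (PadicAlgCl 2)) -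
                iwasawaOToPowerSeries (Set.range ι) (PowerSeries.C ν * w *
                  e (fun i => ((∑ j ∈ Finset.range (2 ^ (2 * m)),
                    Polynomial.C (((π.locd₂ z).comp (AddMonoidHom.single
                      (fun _ : Fin n => ↥(localTowerPointsOfEmb κ (closureEmb (K := ℚ) (π.v.adicCompletion ℚ)) W)) i))
                      ⟨g' ^ j • d' (2 * m), hdA' (2 * m) j⟩) * (Polynomial.X + 1) ^ j : Polynomial ℤ_[2]) : PowerSeries ℤ_[2])))) =
            (((cyclotomicOmega 2 (2 * m)).map (Int.castRingHom (PadicAlgCl 2)) : (PadicAlgCl 2)[X]) : PowerSeries (PadicAlgCl 2)) *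
              iwasawaOToPowerSeries (Set.range ι) q) :
    ∀ (gH : absoluteGaloisGroup (π.v.adicCompletion ℚ)) (dH : ℕ → localPoints W (π.v.adicCompletion ℚ))
      (hdA : ∀ m j, gH ^ j • dH m ∈ localTowerPointsOfEmb κ (closureEmb (K := ℚ) (π.v.adicCompletion ℚ)) W),
      κ.IsTopGenerator (resGalOfEmb (closureEmb (K := ℚ) (π.v.adicCompletion ℚ)) gH) →
      (∀ m, dH m ∈ localLayerPointsOfEmb κ (closureEmb (K := ℚ) (π.v.adicCompletion ℚ)) W m) →
      (∀ m, localTraceOfEmb κ (closureEmb (K := ℚ) (π.v.adicCompletion ℚ)) W (m + 1) (m + 2) (dH (m + 2)) = -dH m) →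
      (∀ b ∈ localLayerPointsOfEmb κ (closureEmb (K := ℚ) (π.v.adicCompletion ℚ)) W 0, dH 0 ≠ 2 • b) →
      (∀ (z' : ↥(localTowerPointsOfEmb κ (closureEmb (K := ℚ) (π.v.adicCompletion ℚ)) W) →+ ℤ_[2]) (m : ℕ),
        (((cyclotomicOmega 2 (2 * m)).map (Int.castRingHom ℤ_[2]) : Polynomial ℤ_[2]) : PowerSeries ℤ_[2]) ∣
          ((∑ j ∈ Finset.range (2 ^ (2 * m)), Polynomial.C (z' ⟨gH ^ j • dH (2 * m), hdA (2 * m) j⟩) * (Polynomial.X + 1) ^ j :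
              Polynomial ℤ_[2]) : PowerSeries ℤ_[2]) +
            (-1 : PowerSeries ℤ_[2]) ^ m * (((cyclotomicOmegaMinus 2 (2 * m)).map (Int.castRingHom ℤ_[2]) : Polynomial ℤ_[2]) :
              PowerSeries ℤ_[2]) * π.col z') →
      (∀ (z' : ↥(localTowerPointsOfEmb κ (closureEmb (K := ℚ) (π.v.adicCompletion ℚ)) W) →+ ℤ_[2])
        (Lz : PowerSeries ℤ_[2]),
        (∀ m : ℕ, (((cyclotomicOmega 2 (2 * m)).map (Int.castRingHom ℤ_[2]) : Polynomial ℤ_[2]) : PowerSeries ℤ_[2]) ∣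
          ((∑ j ∈ Finset.range (2 ^ (2 * m)), Polynomial.C (z' ⟨gH ^ j • dH (2 * m), hdA (2 * m) j⟩) * (Polynomial.X + 1) ^ j :
              Polynomial ℤ_[2]) : PowerSeries ℤ_[2]) +
            (-1 : PowerSeries ℤ_[2]) ^ m * (((cyclotomicOmegaMinus 2 (2 * m)).map (Int.castRingHom ℤ_[2]) : Polynomial ℤ_[2]) :
              PowerSeries ℤ_[2]) * Lz) → Lz = π.col z') →
      ∃ (ν : padicCoeffIntegers (Set.range ι)) (w : IwasawaAlgebraO (Set.range ι)),
        ν ≠ 0 ∧ IsUnit w ∧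
        ∀ m : ℕ, ∃ (k : ℕ) (q : IwasawaAlgebraO (Set.range ι)),
          PowerSeries.C ((2 : PadicAlgCl 2) ^ k) *
              (iwasawaOToPowerSeries (Set.range ι) μt *
                  (((mazurTateElementK g Ω 2 (2 * m)).map ι : (PadicAlgCl 2)[X]) : PowerSeries (PadicAlgCl 2)) -
                iwasawaOToPowerSeries (Set.range ι) (PowerSeries.C ν * w *
                  e (fun i => ((∑ j ∈ Finset.range (2 ^ (2 * m)),
                    Polynomial.C (((π.locd₂ z).comp (AddMonoidHom.single
                      (fun _ : Fin n => ↥(localTowerPointsOfEmb κ (closureEmb (K := ℚ) (π.v.adicCompletion ℚ)) W)) i))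
                      ⟨gH ^ j • dH (2 * m), hdA (2 * m) j⟩) * (Polynomial.X + 1) ^ j : Polynomial ℤ_[2]) : PowerSeries ℤ_[2])))) =
            (((cyclotomicOmega 2 (2 * m)).map (Int.castRingHom (PadicAlgCl 2)) : (PadicAlgCl 2)[X]) : PowerSeries (PadicAlgCl 2)) *
              iwasawaOToPowerSeries (Set.range ι) q := by
  intro gH dH hdA _hgH _hlay _htr _hndiv hcong _hpin
  -- the torsor: `col′ = u · π.col`, and (5) along `(g′, d′)` for `u · π.col`
  obtain ⟨u, -, hcongu⟩ := π.exists_unit_mul_col_of_pin col' g' d' hdA' hg' hd' hcong' hpin' hsurj' hker'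
  obtain ⟨ν, w, hν, hw, H⟩ := hMT'
  refine ⟨ν, w * PowerSeries.map (padicIntToCoeffIntegers (Set.range ι)) (u : PowerSeries ℤ_[2]), hν,
    hw.mul (u.isUnit.map _), fun m ↦ ?_⟩
  obtain ⟨k, q, hk⟩ := H m
  -- T5 + T8: `ω_{2m} ∣ e(P⃗′) − map ι u · e(P⃗)` in `Λ_𝒪`
  have hdvd : (((cyclotomicOmega 2 (2 * m)).map (Int.castRingHom (padicCoeffIntegers (Set.range ι))) :
        (padicCoeffIntegers (Set.range ι))[X]) : IwasawaAlgebraO (Set.range ι)) ∣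
      e (fun i => ((∑ j ∈ Finset.range (2 ^ (2 * m)),
          Polynomial.C (((π.locd₂ z).comp (AddMonoidHom.single
            (fun _ : Fin n => ↥(localTowerPointsOfEmb κ (closureEmb (K := ℚ) (π.v.adicCompletion ℚ)) W)) i))
            ⟨g' ^ j • d' (2 * m), hdA' (2 * m) j⟩) * (Polynomial.X + 1) ^ j : Polynomial ℤ_[2]) : PowerSeries ℤ_[2])) -
        PowerSeries.map (padicIntToCoeffIntegers (Set.range ι)) (u : PowerSeries ℤ_[2]) *
          e (fun i => ((∑ j ∈ Finset.range (2 ^ (2 * m)),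
            Polynomial.C (((π.locd₂ z).comp (AddMonoidHom.single
              (fun _ : Fin n => ↥(localTowerPointsOfEmb κ (closureEmb (K := ℚ) (π.v.adicCompletion ℚ)) W)) i))
              ⟨gH ^ j • dH (2 * m), hdA (2 * m) j⟩) * (Polynomial.X + 1) ^ j : Polynomial ℤ_[2]) : PowerSeries ℤ_[2])) := by
    rw [← map_padicIntToCoeffIntegers_coe_map]
    refine map_dvd_sub_of_forall_dvd (PowerSeries.map (padicIntToCoeffIntegers (Set.range ι))) e he fun i ↦ ?_
    exact dvd_sub_mul_of_congr_pair
      (hcong ((π.locd₂ z).comp (AddMonoidHom.single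
        (fun _ : Fin n => ↥(localTowerPointsOfEmb κ (closureEmb (K := ℚ) (π.v.adicCompletion ℚ)) W)) i)) m)
      (hcongu ((π.locd₂ z).comp (AddMonoidHom.single
        (fun _ : Fin n => ↥(localTowerPointsOfEmb κ (closureEmb (K := ℚ) (π.v.adicCompletion ℚ)) W)) i)) m) rfl
  -- T6: move the cleared congruence (landed `congr_of_dvd_sub`), unit `w ↦ w · map ι u`
  obtain ⟨r, hr⟩ := hdvd
  exact congr_of_dvd_sub ⟨k, q, hk⟩ ⟨PowerSeries.C ν * w * r, by linear_combination (PowerSeries.C ν * w) * hr⟩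

set_option maxHeartbeats 1600000 in
/-- **`hERL` FROM MTV_Λ ALONG ONE HANDED PINNED COLUMN DATUM** (the composition `hMT_of_hMT_along` ∘ `hERL_of_mazurTateValues_at`): station (R)
of the (i)-half at `D := μt` BY NAME, `C ν · e(𝒸 z) = μt · (L⁻ · u)` with `u` a unit, from the Mazur–Tate congruences along a single datum `(g′, d′)`
carrying a pinned `ℤ₂`-column `col′` (e.g. H1's `Col⁺` at the displayed formal Honda datum). [cite: Kato2004Asterisque, Thm. 12.5 (1) (p. 221)]
[cite: Kobayashi2003, Thm. 6.2, (8.23), Prop. 8.25] [cite: Pollack2003, Thm. 5.1, Prop. 6.18] -/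
theorem hERL_of_mazurTateValues_along [FiniteDimensional ℚ_[2] (padicCoeffField (Set.range ι))]
    (π : OnePairPins (Set.range ι) W κ γ S₀ n ρ Θ hΘ I Sg) (z : I.H)
    {Lp Lm : IwasawaAlgebraO (Set.range ι)} (hL : IsPollackPairK g ι Ω Lp Lm)
    (e : (Fin n → PowerSeries ℤ_[2]) ≃+ IwasawaAlgebraO (Set.range ι))
    (he : ∀ (r : PowerSeries ℤ_[2]) (t : Fin n → PowerSeries ℤ_[2]),
      e (r • t) = PowerSeries.map (padicIntToCoeffIntegers (Set.range ι)) r * e t)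
    (μt : IwasawaAlgebraO (Set.range ι))
    (col' : (↥(localTowerPointsOfEmb κ (closureEmb (K := ℚ) (π.v.adicCompletion ℚ)) W) →+ ℤ_[2]) →ₗ[ℤ_[2]] PowerSeries ℤ_[2])
    (g' : absoluteGaloisGroup (π.v.adicCompletion ℚ)) (d' : ℕ → localPoints W (π.v.adicCompletion ℚ))
    (hdA' : ∀ m j, g' ^ j • d' m ∈ localTowerPointsOfEmb κ (closureEmb (K := ℚ) (π.v.adicCompletion ℚ)) W)
    (hg' : κ.IsTopGenerator (resGalOfEmb (closureEmb (K := ℚ) (π.v.adicCompletion ℚ)) g'))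
    (hd' : ∀ m, d' m ∈ localLayerPointsOfEmb κ (closureEmb (K := ℚ) (π.v.adicCompletion ℚ)) W m)
    (hcong' : ∀ (z' : ↥(localTowerPointsOfEmb κ (closureEmb (K := ℚ) (π.v.adicCompletion ℚ)) W) →+ ℤ_[2]) (m : ℕ),
      (((cyclotomicOmega 2 (2 * m)).map (Int.castRingHom ℤ_[2]) : ℤ_[2][X]) : PowerSeries ℤ_[2]) ∣
        ((∑ j ∈ Finset.range (2 ^ (2 * m)), Polynomial.C (z' ⟨g' ^ j • d' (2 * m), hdA' (2 * m) j⟩) * (Polynomial.X + 1) ^ j :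
            ℤ_[2][X]) : PowerSeries ℤ_[2]) +
          (-1 : PowerSeries ℤ_[2]) ^ m * (((cyclotomicOmegaMinus 2 (2 * m)).map (Int.castRingHom ℤ_[2]) : ℤ_[2][X]) : PowerSeries ℤ_[2]) *
            col' z')
    (hpin' : ∀ (z' : ↥(localTowerPointsOfEmb κ (closureEmb (K := ℚ) (π.v.adicCompletion ℚ)) W) →+ ℤ_[2]) (L : PowerSeries ℤ_[2]),
      (∀ m : ℕ, (((cyclotomicOmega 2 (2 * m)).map (Int.castRingHom ℤ_[2]) : ℤ_[2][X]) : PowerSeries ℤ_[2]) ∣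
        ((∑ j ∈ Finset.range (2 ^ (2 * m)), Polynomial.C (z' ⟨g' ^ j • d' (2 * m), hdA' (2 * m) j⟩) * (Polynomial.X + 1) ^ j :
            ℤ_[2][X]) : PowerSeries ℤ_[2]) +
          (-1 : PowerSeries ℤ_[2]) ^ m * (((cyclotomicOmegaMinus 2 (2 * m)).map (Int.castRingHom ℤ_[2]) : ℤ_[2][X]) : PowerSeries ℤ_[2]) *
            L) → L = col' z')
    (hsurj' : Function.Surjective col')
    (hker' : ∀ z' : ↥(localTowerPointsOfEmb κ (closureEmb (K := ℚ) (π.v.adicCompletion ℚ)) W) →+ ℤ_[2],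
      col' z' = 0 ↔ ∀ (m : ℕ) (x : localPoints W (π.v.adicCompletion ℚ)) (hx : x ∈ signedLocalPoints κ (π.v.adicCompletion ℚ) W 1 m),
        z' ⟨x, localLayerPointsOfEmb_le_localTowerPointsOfEmb κ (closureEmb (K := ℚ) (π.v.adicCompletion ℚ)) W m
          (signedLocalPointsOfEmb_le κ (closureEmb (K := ℚ) (π.v.adicCompletion ℚ)) W 1 m hx)⟩ = 0)
    (hMT' : ∃ (ν : padicCoeffIntegers (Set.range ι)) (w : IwasawaAlgebraO (Set.range ι)),
        ν ≠ 0 ∧ IsUnit w ∧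
        ∀ m : ℕ, ∃ (k : ℕ) (q : IwasawaAlgebraO (Set.range ι)),
          PowerSeries.C ((2 : PadicAlgCl 2) ^ k) *
              (iwasawaOToPowerSeries (Set.range ι) μt *
                  (((mazurTateElementK g Ω 2 (2 * m)).map ι : (PadicAlgCl 2)[X]) : PowerSeries (PadicAlgCl 2)) -
                iwasawaOToPowerSeries (Set.range ι) (PowerSeries.C ν * w *
                  e (fun i => ((∑ j ∈ Finset.range (2 ^ (2 * m)),
                    Polynomial.C (((π.locd₂ z).comp (AddMonoidHom.single
                      (fun _ : Fin n => ↥(localTowerPointsOfEmb κ (closureEmb (K := ℚ) (π.v.adicCompletion ℚ)) W)) i))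
                      ⟨g' ^ j • d' (2 * m), hdA' (2 * m) j⟩) * (Polynomial.X + 1) ^ j : Polynomial ℤ_[2]) : PowerSeries ℤ_[2])))) =
            (((cyclotomicOmega 2 (2 * m)).map (Int.castRingHom (PadicAlgCl 2)) : (PadicAlgCl 2)[X]) : PowerSeries (PadicAlgCl 2)) *
              iwasawaOToPowerSeries (Set.range ι) q) :
    ∃ (ν : padicCoeffIntegers (Set.range ι)) (u : IwasawaAlgebraO (Set.range ι)), ν ≠ 0 ∧ IsUnit u ∧
        PowerSeries.C ν * e (π.cvec z) = μt * (Lm * u) :=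
  hERL_of_mazurTateValues_at π z hL e he μt
    (hMT_of_hMT_along π z e he μt col' g' d' hdA' hg' hd' hcong' hpin' hsurj' hker' hMT')

end Transfer

end Summit.BirchSwinnertonDyer.BirchSwinnertonDyer.Theorems.ThetaTransport.MazurTateValuesRelay

end
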